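import Mathlib
import Summits.Ventures.PercRepro2.A3InactiveTyped

/-!
# The region swap `ι₂` and the junction reduction of typed BHK 1.4 (single-vertex)
(blind cell PercRepro2, mine-c g13, 2026-08-25; MINE-C.md §22.3; ASSIGNMENTS v12.58 «the
profile-preserving injection»)

Two-copy vocabulary of `A3InactiveTyped`: at the profile «`F` free, `z` pinned» the first copy is
`y`, the second `A3InactiveTyped.flipOn F y`; `pairCount F z Φ = Σ_y Φ y (A3InactiveTyped.flipOn F y)` over the admissible `y`.
The (TB14) slack is `pairCount F z sameBO − pairCount F z crossBO`.

* `foldBO`: the FOLDED summand `1_Q(y)·1_Q(w)·1_{b∈C₁}(y)·(1_{o∈C₂}(y) − 1_{o∈C₂}(w))`;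
  `pairCount_fold`: the (TB14) slack is `pairCount F z foldBO` (one colouring and its complement).
* `swapRegion` (`ι₂`): complement the free edges touching the REGION of `a₂` (its clusters in
  both copies). `cluster_swapRegion` / `cluster_flip_swapRegion`: the two clusters of `a₂` are
  exchanged exactly; `swapRegion_swapRegion`: `ι₂` is an involution; `swapRegion_agree`: it
  preserves admissibility.
* **`pairCount_fold_ok`**: the part of the folded count on which `b` stays joined to `a₁` after
  the swap vanishes (the summand is antisymmetric under `ι₂`); hence
  **`tb14_slack_eq_junction`**: the (TB14) slack equals the count over the JUNCTION part
  (`b` disconnected from `a₁` after the region swap) — the open content of row 2′TB; and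
  **`tb14_of_no_junction`**: if no admissible configuration with `Q`, `b ∈ C₁`, and the two copies
  disagreeing on `o ∈ C₂` loses `b` under the swap, the (TB14) inequality holds at the profile
  (with equality).
Nothing here proves (TB14); it localises its content. Axioms: standard.
-/

namespace Summit.Ventures.PercRepro2

namespace TB14Fold

open CovForm A3InactiveTyped

section Region

variable {V : Type*} {E : Type*} [DecidableEq E]

/-- The region of `a₂`: the vertices joined to `a₂` in the first copy `y` or in the second copy
`A3InactiveTyped.flipOn F y`. -/
def region (ends : E → Sym2 V) (F : Finset E) (a₂ : V) (y : Config E) : Set V :=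
  cluster ends y a₂ ∪ cluster ends (A3InactiveTyped.flipOn F y) a₂

/-- The free edges touching the region of `a₂`. -/
noncomputable def regionEdges (ends : E → Sym2 V) (F : Finset E) (a₂ : V) (y : Config E) :
    Finset E := by
  classical exact F.filter (fun e => ∃ v ∈ region ends F a₂ y, v ∈ ends e)

/-- `ι₂`: complement the free edges touching the region of `a₂`. -/
noncomputable def swapRegion (ends : E → Sym2 V) (F : Finset E) (a₂ : V) (y : Config E) :
    Config E :=
  A3InactiveTyped.flipOn (regionEdges ends F a₂ y) y

/-- The region edges are free edges. -/
lemma regionEdges_subset (ends : E → Sym2 V) (F : Finset E) (a₂ : V) (y : Config E) :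
    regionEdges ends F a₂ y ⊆ F := by
  classical
  intro e he
  simp only [regionEdges] at he
  exact (Finset.mem_filter.1 he).1

/-- A free edge with an endpoint in the region is a region edge. -/
lemma mem_regionEdges {ends : E → Sym2 V} {F : Finset E} {a₂ : V} {y : Config E} {e : E}
    (heF : e ∈ F) {v : V} (hv : v ∈ region ends F a₂ y) (hve : v ∈ ends e) :
    e ∈ regionEdges ends F a₂ y := by
  classical
  simp only [regionEdges]
  exact Finset.mem_filter.2 ⟨heF, v, hv, hve⟩

/-- `ι₂` does not change the configuration off `F`. -/
lemma swapRegion_of_notMem {ends : E → Sym2 V} {F : Finset E} {a₂ : V} {y : Config E} {e : E}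
    (he : e ∉ F) : swapRegion ends F a₂ y e = y e := by
  have hD : e ∉ regionEdges ends F a₂ y := fun h => he (regionEdges_subset ends F a₂ y h)
  simp [swapRegion, A3InactiveTyped.flipOn, hD]

/-- `ι₂` preserves admissibility. -/
lemma swapRegion_agree {ends : E → Sym2 V} {F : Finset E} {a₂ : V} {y z : Config E}
    (h : ∀ e, e ∉ F → y e = z e) : ∀ e, e ∉ F → swapRegion ends F a₂ y e = z e := by
  intro e he
  rw [swapRegion_of_notMem he]
  exact h e he

/-- The value of `ι₂ y` on an edge of `F`, by cases on the region edges. -/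
lemma swapRegion_apply {ends : E → Sym2 V} {F : Finset E} {a₂ : V} {y : Config E} {e : E} :
    swapRegion ends F a₂ y e = if e ∈ regionEdges ends F a₂ y then !(y e) else y e := rfl

/-- The second copy of `ι₂ y` on an edge: `y e` on region edges and off `F`, `!(y e)` on the
other free edges. -/
lemma flip_swapRegion_apply {ends : E → Sym2 V} {F : Finset E} {a₂ : V} {y : Config E} {e : E} :
    A3InactiveTyped.flipOn F (swapRegion ends F a₂ y) e =
      if e ∈ F then (if e ∈ regionEdges ends F a₂ y then y e else !(y e)) else y e := by
  by_cases heF : e ∈ F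
  · by_cases heD : e ∈ regionEdges ends F a₂ y
    · simp [A3InactiveTyped.flipOn, swapRegion, heD, heF]
    · simp [A3InactiveTyped.flipOn, swapRegion, heD, heF]
  · have hD : e ∉ regionEdges ends F a₂ y := fun h => heF (regionEdges_subset ends F a₂ y h)
    simp [A3InactiveTyped.flipOn, swapRegion, hD, heF]

/-- A `y'`-edge at a vertex of the old second cluster carries the second copy's state:
`ι₂ y e = A3InactiveTyped.flipOn F y e` whenever some endpoint of `e` lies in `C_{A3InactiveTyped.flipOn F y}(a₂)`. -/
lemma swapRegion_eq_flip_of_touch {ends : E → Sym2 V} {F : Finset E} {a₂ : V} {y : Config E}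
    {x : V} (hx : x ∈ cluster ends (A3InactiveTyped.flipOn F y) a₂) {e : E} (hxe : x ∈ ends e) :
    swapRegion ends F a₂ y e = A3InactiveTyped.flipOn F y e := by
  by_cases heF : e ∈ F
  · have heD : e ∈ regionEdges ends F a₂ y := mem_regionEdges heF (Or.inr hx) hxe
    simp [swapRegion, A3InactiveTyped.flipOn, heD, heF]
  · have hD : e ∉ regionEdges ends F a₂ y := fun h => heF (regionEdges_subset ends F a₂ y h)
    simp [swapRegion, A3InactiveTyped.flipOn, hD, heF]

/-- The second copy of `ι₂ y` at a vertex of the old first cluster carries the first copy's state: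
`A3InactiveTyped.flipOn F (ι₂ y) e = y e` whenever some endpoint of `e` lies in `C_y(a₂)`. -/
lemma flip_swapRegion_eq_of_touch {ends : E → Sym2 V} {F : Finset E} {a₂ : V} {y : Config E}
    {x : V} (hx : x ∈ cluster ends y a₂) {e : E} (hxe : x ∈ ends e) :
    A3InactiveTyped.flipOn F (swapRegion ends F a₂ y) e = y e := by
  by_cases heF : e ∈ F
  · have heD : e ∈ regionEdges ends F a₂ y := mem_regionEdges heF (Or.inl hx) hxe
    rw [flip_swapRegion_apply, if_pos heF, if_pos heD]
  · rw [flip_swapRegion_apply, if_neg heF]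

omit [DecidableEq E] in
/-- An endpoint belongs to its edge. -/
lemma mem_ends_of_eq {ends : E → Sym2 V} {e : E} {x v : V} (h : ends e = s(x, v)) : x ∈ ends e := by
  rw [h]; exact Sym2.mem_mk_left x v

/-- **The first cluster after the swap is the old second cluster**:
`C_{ι₂ y}(a₂) = C_{A3InactiveTyped.flipOn F y}(a₂)`. -/
theorem cluster_swapRegion (ends : E → Sym2 V) (F : Finset E) (a₂ : V) (y : Config E) :
    cluster ends (swapRegion ends F a₂ y) a₂ = cluster ends (A3InactiveTyped.flipOn F y) a₂ := by
  -- (⊆): the old second cluster is closed under `ι₂ y`-adjacency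
  have hsub : cluster ends (swapRegion ends F a₂ y) a₂ ⊆ cluster ends (A3InactiveTyped.flipOn F y) a₂ := by
    intro u hu
    refine mem_of_conn_of_closed (S := cluster ends (A3InactiveTyped.flipOn F y) a₂) ?_
      (mem_cluster_self ends _ a₂) hu
    intro x hx v hxv
    obtain ⟨_, e, he, hends⟩ := openGraph_adj.1 hxv
    have hxe : x ∈ ends e := mem_ends_of_eq hends
    have : A3InactiveTyped.flipOn F y e = true := by rw [← swapRegion_eq_flip_of_touch hx hxe]; exact he
    exact mem_cluster_of_adj hx (openGraph_adj.2 ⟨(openGraph_adj.1 hxv).1, e, this, hends⟩)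
  refine Set.Subset.antisymm hsub ?_
  -- (⊇): the new first cluster is closed under `A3InactiveTyped.flipOn F y`-adjacency
  intro u hu
  refine mem_of_conn_of_closed (S := cluster ends (swapRegion ends F a₂ y) a₂) ?_
    (mem_cluster_self ends _ a₂) hu
  intro x hx v hxv
  obtain ⟨hne, e, he, hends⟩ := openGraph_adj.1 hxv
  have hxe : x ∈ ends e := mem_ends_of_eq hends
  have : swapRegion ends F a₂ y e = true := by
    rw [swapRegion_eq_flip_of_touch (hsub hx) hxe]; exact he
  exact mem_cluster_of_adj hx (openGraph_adj.2 ⟨hne, e, this, hends⟩)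

/-- **The second cluster after the swap is the old first cluster**:
`C_{A3InactiveTyped.flipOn F (ι₂ y)}(a₂) = C_y(a₂)`. -/
theorem cluster_flip_swapRegion (ends : E → Sym2 V) (F : Finset E) (a₂ : V) (y : Config E) :
    cluster ends (A3InactiveTyped.flipOn F (swapRegion ends F a₂ y)) a₂ = cluster ends y a₂ := by
  have hsub : cluster ends (A3InactiveTyped.flipOn F (swapRegion ends F a₂ y)) a₂ ⊆ cluster ends y a₂ := by
    intro u hu
    refine mem_of_conn_of_closed (S := cluster ends y a₂) ?_ (mem_cluster_self ends _ a₂) hu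
    intro x hx v hxv
    obtain ⟨hne, e, he, hends⟩ := openGraph_adj.1 hxv
    have hxe : x ∈ ends e := mem_ends_of_eq hends
    have : y e = true := by rw [← flip_swapRegion_eq_of_touch hx hxe]; exact he
    exact mem_cluster_of_adj hx (openGraph_adj.2 ⟨hne, e, this, hends⟩)
  refine Set.Subset.antisymm hsub ?_
  intro u hu
  refine mem_of_conn_of_closed (S := cluster ends (A3InactiveTyped.flipOn F (swapRegion ends F a₂ y)) a₂) ?_
    (mem_cluster_self ends _ a₂) hu
  intro x hx v hxv
  obtain ⟨hne, e, he, hends⟩ := openGraph_adj.1 hxv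
  have hxe : x ∈ ends e := mem_ends_of_eq hends
  have : A3InactiveTyped.flipOn F (swapRegion ends F a₂ y) e = true := by
    rw [flip_swapRegion_eq_of_touch (hsub hx) hxe]; exact he
  exact mem_cluster_of_adj hx (openGraph_adj.2 ⟨hne, e, this, hends⟩)

/-- The region is invariant under `ι₂`. -/
lemma region_swapRegion (ends : E → Sym2 V) (F : Finset E) (a₂ : V) (y : Config E) :
    region ends F a₂ (swapRegion ends F a₂ y) = region ends F a₂ y := by
  simp only [region, cluster_swapRegion, cluster_flip_swapRegion]
  exact Set.union_comm _ _

/-- The region edges are invariant under `ι₂`. -/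
lemma regionEdges_swapRegion (ends : E → Sym2 V) (F : Finset E) (a₂ : V) (y : Config E) :
    regionEdges ends F a₂ (swapRegion ends F a₂ y) = regionEdges ends F a₂ y := by
  classical
  simp only [regionEdges, region_swapRegion]

/-- **`ι₂` is an involution.** -/
theorem swapRegion_swapRegion (ends : E → Sym2 V) (F : Finset E) (a₂ : V) (y : Config E) :
    swapRegion ends F a₂ (swapRegion ends F a₂ y) = y := by
  conv_lhs => rw [swapRegion, regionEdges_swapRegion]
  exact A3InactiveTyped.flipOn_flipOn _ _

end Region

section Fold

variable {V : Type} {E : Type} [Fintype E] [DecidableEq E] {R : Type*} [Field R]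

omit [Fintype E] [DecidableEq E] in
/-- Membership in the `Q`-event: `a₂ ↮ a₁`. -/
lemma mem_avoidAll_singleton {ends : E → Sym2 V} {a₁ a₂ : V} {ω : Config E} :
    ω ∈ avoidAll ends a₂ {a₁} ↔ ¬ Conn ends ω a₂ a₁ := by
  simp [avoidAll]

omit [Fintype E] [DecidableEq E] in
open Classical in
/-- `1_Q` through the cluster of `a₂`. -/
lemma iQ_eq_ite (ends : E → Sym2 V) (a₁ a₂ : V) (ω : Config E) :
    (iQ ends a₁ a₂ ω : R) = if a₁ ∈ cluster ends ω a₂ then 0 else 1 := by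
  by_cases h : a₁ ∈ cluster ends ω a₂
  · have : ω ∉ avoidAll ends a₂ {a₁} := fun hω => (mem_avoidAll_singleton.1 hω) h
    rw [if_pos h]
    simp [iQ, Set.indicator_of_notMem this]
  · have : ω ∈ avoidAll ends a₂ {a₁} := mem_avoidAll_singleton.2 h
    rw [if_neg h]
    simp [iQ, Set.indicator_of_mem this]

omit [Fintype E] [DecidableEq E] in
open Classical in
/-- `1_{o ∈ C₂}` through the cluster of `a₂`. -/
lemma iH_eq_ite (ends : E → Sym2 V) (a₂ o : V) (ω : Config E) :
    (iH ends a₂ o ω : R) = if o ∈ cluster ends ω a₂ then 1 else 0 := by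
  by_cases h : o ∈ cluster ends ω a₂
  · rw [if_pos h]
    simp [iH, Set.indicator_of_mem (show ω ∈ connEvent ends a₂ o from h)]
  · rw [if_neg h]
    simp [iH, Set.indicator_of_notMem (show ω ∉ connEvent ends a₂ o from h)]

omit [Fintype E] in
/-- `1_Q` is transported by the region swap: first copy ↦ old second copy. -/
lemma iQ_swapRegion (ends : E → Sym2 V) (F : Finset E) (a₁ a₂ : V) (y : Config E) :
    (iQ ends a₁ a₂ (swapRegion ends F a₂ y) : R) = iQ ends a₁ a₂ (A3InactiveTyped.flipOn F y) := by
  rw [iQ_eq_ite, iQ_eq_ite, cluster_swapRegion]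

omit [Fintype E] in
/-- `1_Q` is transported by the region swap: second copy ↦ old first copy. -/
lemma iQ_flip_swapRegion (ends : E → Sym2 V) (F : Finset E) (a₁ a₂ : V) (y : Config E) :
    (iQ ends a₁ a₂ (A3InactiveTyped.flipOn F (swapRegion ends F a₂ y)) : R) = iQ ends a₁ a₂ y := by
  rw [iQ_eq_ite, iQ_eq_ite, cluster_flip_swapRegion]

omit [Fintype E] in
/-- `1_{o ∈ C₂}` is transported by the region swap: first copy ↦ old second copy. -/
lemma iH_swapRegion (ends : E → Sym2 V) (F : Finset E) (a₂ o : V) (y : Config E) :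
    (iH ends a₂ o (swapRegion ends F a₂ y) : R) = iH ends a₂ o (A3InactiveTyped.flipOn F y) := by
  rw [iH_eq_ite, iH_eq_ite, cluster_swapRegion]

omit [Fintype E] in
/-- `1_{o ∈ C₂}` is transported by the region swap: second copy ↦ old first copy. -/
lemma iH_flip_swapRegion (ends : E → Sym2 V) (F : Finset E) (a₂ o : V) (y : Config E) :
    (iH ends a₂ o (A3InactiveTyped.flipOn F (swapRegion ends F a₂ y)) : R) = iH ends a₂ o y := by
  rw [iH_eq_ite, iH_eq_ite, cluster_flip_swapRegion]

/-- **The folded summand** of (TB14):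
`1_Q(y) · 1_Q(w) · 1_{b∈C₁}(y) · (1_{o∈C₂}(y) − 1_{o∈C₂}(w))`. -/
noncomputable def foldBO (ends : E → Sym2 V) (a₁ a₂ b o : V) : Config E → Config E → R :=
  fun y w => iQ ends a₁ a₂ y * iQ ends a₁ a₂ w * iL ends a₁ b y *
    (iH ends a₂ o y - iH ends a₂ o w)

omit [Fintype E] [DecidableEq E] in
/-- Pointwise: «same» minus «cross with the copies exchanged» is the folded summand. -/
lemma sameBO_sub_crossSw (ends : E → Sym2 V) (a₁ a₂ b o : V) :
    (fun y w => sameBO ends a₁ a₂ b o y w - crossSw ends a₁ a₂ b o y w :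
      Config E → Config E → R) = foldBO ends a₁ a₂ b o := by
  funext y w
  simp only [sameBO, crossSw, crossBO, foldBO]
  ring

/-- **The (TB14) slack is the folded count**: `N(QAB, Q) − N(QB, QA) = pairCount F z foldBO`. -/
theorem pairCount_fold (ends : E → Sym2 V) (a₁ a₂ b o : V) (F : Finset E) (z : Config E) :
    pairCount F z (sameBO ends a₁ a₂ b o : Config E → Config E → R) -
      pairCount F z (crossBO ends a₁ a₂ b o) = pairCount F z (foldBO ends a₁ a₂ b o) := by
  rw [← pairCount_crossSw, ← pairCount_sub, sameBO_sub_crossSw]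

/-- The «ok» summand: the folded summand weighted by `1_{b ∈ C₁}(ι₂ y)` (`b` stays joined to `a₁`
after the region swap). -/
noncomputable def okBO (ends : E → Sym2 V) (a₁ a₂ b o : V) (F : Finset E) :
    Config E → Config E → R :=
  fun y w => foldBO ends a₁ a₂ b o y w * iL ends a₁ b (swapRegion ends F a₂ y)

/-- The «junction» summand: the folded summand weighted by `1 − 1_{b ∈ C₁}(ι₂ y)` (`b` is cut
from `a₁` by the region swap). -/
noncomputable def junctionBO (ends : E → Sym2 V) (a₁ a₂ b o : V) (F : Finset E) :
    Config E → Config E → R :=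
  fun y w => foldBO ends a₁ a₂ b o y w * (1 - iL ends a₁ b (swapRegion ends F a₂ y))

/-- The admissible summand of the «ok» count, as a function of the first copy. -/
noncomputable def okTerm (ends : E → Sym2 V) (a₁ a₂ b o : V) (F : Finset E) (z : Config E)
    (y : Config E) : R :=
  if (∀ e, e ∉ F → y e = z e) then okBO ends a₁ a₂ b o F y (A3InactiveTyped.flipOn F y) else 0

omit [Fintype E] in
/-- Admissibility is invariant under `ι₂`. -/
lemma agree_swapRegion_iff (ends : E → Sym2 V) (F : Finset E) (a₂ : V) (y z : Config E) :
    (∀ e, e ∉ F → swapRegion ends F a₂ y e = z e) ↔ (∀ e, e ∉ F → y e = z e) := by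
  constructor
  · intro h e he
    have := swapRegion_agree (ends := ends) (a₂ := a₂) h e he
    rwa [swapRegion_swapRegion] at this
  · exact swapRegion_agree

/-- **Antisymmetry**: the «ok» summand changes sign under `ι₂`. -/
lemma okTerm_swapRegion (ends : E → Sym2 V) (a₁ a₂ b o : V) (F : Finset E) (z : Config E)
    (y : Config E) :
    (okTerm ends a₁ a₂ b o F z (swapRegion ends F a₂ y) : R) = - okTerm ends a₁ a₂ b o F z y := by
  simp only [okTerm, agree_swapRegion_iff]
  split_ifs with h
  · simp only [okBO, foldBO, iQ_swapRegion, iQ_flip_swapRegion, iH_swapRegion, iH_flip_swapRegion,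
      swapRegion_swapRegion]
    ring
  · simp

/-- A fixed point of `ι₂` has a vanishing «ok» summand (its two copies agree on `o ∈ C₂`). -/
lemma okTerm_eq_zero_of_fixed (ends : E → Sym2 V) (a₁ a₂ b o : V) (F : Finset E) (z : Config E)
    (y : Config E) (hy : swapRegion ends F a₂ y = y) : (okTerm ends a₁ a₂ b o F z y : R) = 0 := by
  have hH : (iH ends a₂ o y : R) = iH ends a₂ o (A3InactiveTyped.flipOn F y) := by
    rw [← iH_swapRegion ends F a₂ o y, hy]
  simp only [okTerm, okBO, foldBO]
  split_ifs
  · rw [hH]; ring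
  · rfl

/-- **The «ok» count vanishes**: the summand is antisymmetric under the involution `ι₂`. -/
theorem pairCount_fold_ok (ends : E → Sym2 V) (a₁ a₂ b o : V) (F : Finset E) (z : Config E) :
    pairCount F z (okBO ends a₁ a₂ b o F : Config E → Config E → R) = 0 := by
  show ∑ y : Config E, (okTerm ends a₁ a₂ b o F z y : R) = 0
  refine Finset.sum_involution (fun y _ => swapRegion ends F a₂ y) ?_ ?_ ?_ ?_
  · intro y _
    rw [okTerm_swapRegion]; ring
  · intro y _ hne hfix
    exact hne (okTerm_eq_zero_of_fixed ends a₁ a₂ b o F z y hfix)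
  · intro y _; exact Finset.mem_univ _
  · intro y _; exact swapRegion_swapRegion ends F a₂ y

/-- **The (TB14) slack is the junction count**:
`N(QAB, Q) − N(QB, QA) = pairCount F z junctionBO` — the whole content of typed BHK 1.4 for
single-vertex events sits on the configurations in which the region swap `ι₂` cuts `b` from `a₁`. -/
theorem tb14_slack_eq_junction (ends : E → Sym2 V) (a₁ a₂ b o : V) (F : Finset E)
    (z : Config E) :
    pairCount F z (sameBO ends a₁ a₂ b o : Config E → Config E → R) -
      pairCount F z (crossBO ends a₁ a₂ b o) =
      pairCount F z (junctionBO ends a₁ a₂ b o F) := by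
  rw [pairCount_fold]
  have hsplit : (foldBO ends a₁ a₂ b o : Config E → Config E → R) =
      fun y w => okBO ends a₁ a₂ b o F y w + junctionBO ends a₁ a₂ b o F y w := by
    funext y w
    simp only [okBO, junctionBO]
    ring
  rw [hsplit, pairCount_add, pairCount_fold_ok, zero_add]

/-- **(TB14) without junctions**: if on every admissible first copy with `a₁ ↮ a₂` in both copies
and `b ∈ C₁`, the region swap keeps `b` joined to `a₁`, then the (TB14) inequality holds at the
profile — with equality. -/
theorem tb14_of_no_junction (ends : E → Sym2 V) (a₁ a₂ b o : V) (F : Finset E) (z : Config E)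
    (h : ∀ y : Config E, (∀ e, e ∉ F → y e = z e) → ¬ Conn ends y a₂ a₁ →
      ¬ Conn ends (A3InactiveTyped.flipOn F y) a₂ a₁ → Conn ends y a₁ b →
      Conn ends (swapRegion ends F a₂ y) a₁ b) :
    pairCount F z (sameBO ends a₁ a₂ b o : Config E → Config E → R) =
      pairCount F z (crossBO ends a₁ a₂ b o) := by
  rw [← sub_eq_zero, tb14_slack_eq_junction]
  unfold pairCount
  refine Finset.sum_eq_zero fun y _ => ?_
  split_ifs with hy
  · simp only [junctionBO, foldBO]
    by_cases hQ : Conn ends y a₂ a₁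
    · have : (iQ ends a₁ a₂ y : R) = 0 := by
        rw [iQ_eq_ite, if_pos (show a₁ ∈ cluster ends y a₂ from hQ)]
      rw [this]; ring
    by_cases hQ' : Conn ends (A3InactiveTyped.flipOn F y) a₂ a₁
    · have : (iQ ends a₁ a₂ (A3InactiveTyped.flipOn F y) : R) = 0 := by
        rw [iQ_eq_ite, if_pos (show a₁ ∈ cluster ends (A3InactiveTyped.flipOn F y) a₂ from hQ')]
      rw [this]; ring
    by_cases hb : Conn ends y a₁ b
    · have : (iL ends a₁ b (swapRegion ends F a₂ y) : R) = 1 := by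
        simp [iL, Set.indicator_of_mem (show swapRegion ends F a₂ y ∈ connEvent ends a₁ b from
          h y hy hQ hQ' hb)]
      rw [this]; ring
    · have : (iL ends a₁ b y : R) = 0 := by
        simp [iL, Set.indicator_of_notMem (show y ∉ connEvent ends a₁ b from hb)]
      rw [this]; ring
  · rfl

end Fold

end TB14Fold

end Summit.Ventures.PercRepro2
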